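import Summits.ResolutionOfSingularities.ResolutionOfSingularities.Theorems.FrobeniusLadderFInjectiveMacaulayficationMonomialChartPresentationPrime
import HarnessLib

/-!
# [OURS · L1 W4.5a] E7 R3 bridge `MonomialChartPresentationValues` — the VALUES of a C1 chart presentation on the chart coordinates:
# `θ(ȳᵢ) · x̄^m/1 = x̄^{aᵢ}/1`, i.e. `θ(ȳᵢ) = x̄^{aᵢ}/x̄^m` (numerator form), from the registered per-variable specification

Crux `FrobeniusLadder.FInjectiveMacaulayfication` = stmt-ResolutionOfSingularities-15315 (chain w45a), hole 5e, E7 instance layer (R3,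
res-L1-w45a-plan-1 R12.60 (4) / R13.13 (4)). Companion of `AffineBlowupChartRestriction(Units)` and of res-L1-w45a-stub-1's C1
`MonomialChartPresentationPrime.stub_monomialChartPresentation` (p495258). Helper `--supports stmt-ResolutionOfSingularities-15315 --as helper`,
typed by res-type-034. OURS: replaces the role of NOTHING in H. Hironaka's manuscript and is NOT a statement of it; AI-written kernel glue
of the cell `res-hironaka`, weaker than expert review. No definition, no named fact.

THE POINT. The registered presentation of a toric/Rees chart is an `e : k[y]/(g) ≃+* R̄[I_A R̄/x̄^m]` specified ONLY on the total
transforms of the variables: `(e (ȳ^{V e_j})).val = x̄_j/1` (unimodular `V`). The R3 data half (`hJ c`, `hScover` of the two-level frame,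
see `HOME/plan/tools/res-type-034/R3-DATA-HALF-RECIPE.md`) reads chart polynomials in NUMERATOR FORM `x/(x̄^m t)ⁿ`, which needs the values of
`e` on the chart coordinates `ȳᵢ` themselves. For ANY ring map `θ : k[y]/(g) → R̄[1/x̄^m]` with the per-variable specification (no
`k`-linearity assumed — a ring map need not fix the constants) and chart exponents `aᵢ` with `V·aᵢ = V·m + eᵢ` (`hgen`, the binder of
`CNConeFiModel` / `CICertificates`):
* `apply_mk_prod_pow_eq` — `θ` on the total transform of ANY coefficient-one monomial: `θ(∏_j (ȳ^{V e_j})^{c_j}) = x̄^c/1`;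
* **`apply_mk_X_mul_algebraMap_monomial`** — `θ(ȳᵢ) · (x̄^m/1) = x̄^{aᵢ}/1` (the exponent identity `∏_j (y^{V e_j})^{(aᵢ)_j} = (∏_j (y^{V e_j})^{m_j}) · yᵢ`
  is `ToricChartFedder.theta_monomial` + `hgen`);
* **`apply_mk_X_eq`** — `θ(ȳᵢ) = x̄^{aᵢ}/1 · (x̄^m/1)⁻¹` (`IsLocalization.Away.invSelf`), the numerator form `x̄^{aᵢ}/x̄^m` consumed by
  `AffineBlowupChartTransport.reesChartEquiv_mk_reesT`.
References: folklore (toric charts of a monomial blow-up); W. Fulton, *Introduction to Toric Varieties* §2.1 — background only.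
-/

-- single-problem summit: the doubled namespace component is forced
set_option linter.dupNamespace false

noncomputable section

open MvPolynomial
open Summit.ResolutionOfSingularities.ResolutionOfSingularities.Theorems.FInjectiveMacaulayfication

namespace Summit.ResolutionOfSingularities.ResolutionOfSingularities.Theorems.FInjectiveMacaulayfication.MonomialChartPresentationValues

variable {k : Type} [Field k] {n : ℕ} (V : Matrix (Fin n) (Fin n) ℕ) (m : Fin n →₀ ℕ) (f g : MvPolynomial (Fin n) k)
  {L : Type} [CommRing L] [Algebra (MvPolynomial (Fin n) k ⧸ Ideal.span {f}) L]
  (θ : (MvPolynomial (Fin n) k ⧸ Ideal.span {g}) →+* L)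
  (hθ : ∀ j : Fin n, θ (Ideal.Quotient.mk (Ideal.span {g}) (∏ i : Fin n, (X i : MvPolynomial (Fin n) k) ^ V i j)) =
    algebraMap (MvPolynomial (Fin n) k ⧸ Ideal.span {f}) L (Ideal.Quotient.mk (Ideal.span {f}) (X j)))

include hθ in
/-- **`θ` on the total transform of a coefficient-one monomial**: `θ(∏_j (∏_i yᵢ^{V i j})^{c_j}) = x̄^c/1` (multiplicativity of `θ` and the
per-variable specification; no `k`-linearity of `θ` is used). [folklore] -/
theorem apply_mk_prod_pow_eq (c : Fin n →₀ ℕ) :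
    θ (Ideal.Quotient.mk (Ideal.span {g}) (∏ j : Fin n, (∏ i : Fin n, (X i : MvPolynomial (Fin n) k) ^ V i j) ^ c j)) =
      algebraMap (MvPolynomial (Fin n) k ⧸ Ideal.span {f}) L (Ideal.Quotient.mk (Ideal.span {f}) (monomial c (1 : k))) := by
  rw [map_prod, map_prod]
  simp_rw [map_pow, hθ, ← map_pow]
  rw [← map_prod, ← map_prod, MvPolynomial.monomial_eq, C_1, one_mul, Finsupp.prod_fintype _ _ (fun j => by simp)]

/-- The total transform of a coefficient-one monomial, as a product of powers of the transformed variables: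
`∏_j (∏_i yᵢ^{V i j})^{c_j} = y^{V·c}`. [folklore] -/
theorem prod_pow_eq_monomial (c : Fin n →₀ ℕ) :
    (∏ j : Fin n, (∏ i : Fin n, (X i : MvPolynomial (Fin n) k) ^ V i j) ^ c j) =
      monomial (Finsupp.equivFunOnFinite.symm (V.mulVec ⇑c)) (1 : k) := by
  rw [← ToricChartFedder.theta_monomial V c (1 : k), aeval_monomial, algebraMap_eq, C_1, one_mul,
    Finsupp.prod_fintype _ _ (fun j => by simp)]

variable (a : Fin n → (Fin n →₀ ℕ))
  (hgen : ∀ i : Fin n, (Finsupp.equivFunOnFinite.symm (V.mulVec ⇑(a i)) : Fin n →₀ ℕ) =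
    Finsupp.equivFunOnFinite.symm (V.mulVec ⇑m) + Finsupp.single i 1)

include hθ hgen in
/-- **`θ(ȳᵢ) · (x̄^m/1) = x̄^{aᵢ}/1`**: the chart coordinate `yᵢ` times the total transform of the chart monomial `x^m` is the total
transform of `x^{aᵢ}` (`V·aᵢ = V·m + eᵢ`), and `θ` is multiplicative. [folklore] -/
theorem apply_mk_X_mul_algebraMap_monomial (i : Fin n) :
    θ (Ideal.Quotient.mk (Ideal.span {g}) (X i)) *
        algebraMap (MvPolynomial (Fin n) k ⧸ Ideal.span {f}) L (Ideal.Quotient.mk (Ideal.span {f}) (monomial m (1 : k))) =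
      algebraMap (MvPolynomial (Fin n) k ⧸ Ideal.span {f}) L (Ideal.Quotient.mk (Ideal.span {f}) (monomial (a i) (1 : k))) := by
  -- the exponent identity `y^{V·aᵢ} = y^{V·m} · yᵢ` as polynomials
  have hpoly : (∏ j : Fin n, (∏ i' : Fin n, (X i' : MvPolynomial (Fin n) k) ^ V i' j) ^ (a i) j) =
      X i * ∏ j : Fin n, (∏ i' : Fin n, (X i' : MvPolynomial (Fin n) k) ^ V i' j) ^ m j := by
    rw [prod_pow_eq_monomial V (a i), prod_pow_eq_monomial V m, hgen i, add_comm, ← mul_one (1 : k), ← monomial_mul, mul_one,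
      X, mul_comm]
  rw [← apply_mk_prod_pow_eq V f g θ hθ m, ← apply_mk_prod_pow_eq V f g θ hθ (a i), ← map_mul, ← map_mul, hpoly]

include hθ hgen in
/-- **`θ(ȳᵢ) = x̄^{aᵢ}/1 · (x̄^m/1)⁻¹` in `R̄[1/x̄^m]`** — the numerator form `x̄^{aᵢ}/x̄^m` of the chart coordinate. [folklore] -/
theorem apply_mk_X_eq [IsLocalization.Away (Ideal.Quotient.mk (Ideal.span {f}) (monomial m (1 : k))) L] (i : Fin n) :
    θ (Ideal.Quotient.mk (Ideal.span {g}) (X i)) =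
      algebraMap (MvPolynomial (Fin n) k ⧸ Ideal.span {f}) L (Ideal.Quotient.mk (Ideal.span {f}) (monomial (a i) (1 : k))) *
        IsLocalization.Away.invSelf (S := L) (Ideal.Quotient.mk (Ideal.span {f}) (monomial m (1 : k))) := by
  rw [← apply_mk_X_mul_algebraMap_monomial V m f g θ hθ a hgen i, mul_assoc, IsLocalization.Away.mul_invSelf, mul_one]

end Summit.ResolutionOfSingularities.ResolutionOfSingularities.Theorems.FInjectiveMacaulayfication.MonomialChartPresentationValues

end
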